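import Summits.ResolutionOfSingularities.ResolutionOfSingularities.Theorems.MaxContactCutDeltaFaceCut

/-!
# MaxContactCutDeltaFaceCutAsides — the route asides of node «DeltaFaceCut» unfolded and keyed BY NAME
(decomp-res writer g4; companion of `MaxContactCutDeltaFaceCut`, filed once the asides
`MaxContactCut.DFGenericRung`, `MaxContactCut.DFSpecialRung`, `MaxContactCut.DFSpecialNonIso`,
`MaxContactCut.DFSpecialIso` exist on the route).  Every statement here is an `Iff.rfl` unfolding or a by-name
re-keying of a kernel of `MaxContactCutDeltaFaceCut`; 0 sorry. [folklore]
-/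

namespace Summit.ResolutionOfSingularities.ResolutionOfSingularities.Theorems.MaxContactCutDeltaFaceCutAsides

open CategoryTheory AlgebraicGeometry TopologicalSpace IsLocalRing
open Literature.AlgebraicGeometry.Resolution
open Summit.ResolutionOfSingularities.ResolutionOfSingularities.Theses
open Summit.ResolutionOfSingularities.ResolutionOfSingularities.Theorems
open Summit.ResolutionOfSingularities.ResolutionOfSingularities.Theorems.WeakOrderReduction
open DeltaFaceCutClasses DeltaFaceCutKernels
open MaxContactCutDeltaFaceCut

/-! ## The asides unfolded -/

/-- `DFGenericRung` is the δ-generic decided half. [folklore] -/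
theorem dfGenericRung_iff : MaxContactCut.DFGenericRung ↔ DeltaGenericRung := Iff.rfl

/-- `DFSpecialRung` is the δ-special located residual. [folklore] -/
theorem dfSpecialRung_iff : MaxContactCut.DFSpecialRung ↔ DeltaSpecialRung := Iff.rfl

/-- `DFSpecialNonIso` is the non-isolated column of the residual. [folklore] -/
theorem dfSpecialNonIso_iff : MaxContactCut.DFSpecialNonIso ↔ (E 2 → ∀ n : ℕ, 1 ≤ n → SeqDSpecNonIso n) := Iff.rfl

/-- `DFSpecialIso` is the isolated column of the residual. [folklore] -/
theorem dfSpecialIso_iff : MaxContactCut.DFSpecialIso ↔ (E 2 → ∀ n : ℕ, 1 ≤ n → SeqDSpecIso n) := Iff.rfl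

/-! ## The node keyed to the asides -/

/-- **EXACT**: 29273 ⟺ the two asides. [folklore] -/
theorem rungOne_iff_asides : MaxContactCut.RungOne ↔ MaxContactCut.DFGenericRung ∧ MaxContactCut.DFSpecialRung :=
  rungOne_iff

/-- `RungOne` BY NAME from the two asides. [folklore] -/
theorem closes_of_asides (hG : MaxContactCut.DFGenericRung) (hS : MaxContactCut.DFSpecialRung) : MaxContactCut.RungOne :=
  closes hG hS

/-- NECESSITY: both asides are implied by 29273 (WEAKER by letter, port-free). [folklore] -/
theorem asides_of_rungOne (h : MaxContactCut.RungOne) : MaxContactCut.DFGenericRung ∧ MaxContactCut.DFSpecialRung :=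
  rungOne_iff.mp h

/-- **`DFGenericRung` is DECIDED modulo the engines and ports** (prover target #19″ = `DeltaPackageExit`). [folklore] -/
theorem dfGenericRung_of_engines (hF : FaceFormCutClasses.FaceFormExit) (hD : DeltaPackageExit)
    (hP : ∀ n : ℕ, 2 ≤ n → PackagePort n) (h1 : FaceFormCutClasses.OrderOneContact) : MaxContactCut.DFGenericRung :=
  deltaGenericRung_of_engines hF hD hP h1

/-- **EXACT**: the residual aside ⟺ its two isolation-column asides. [folklore] -/
theorem dfSpecialRung_iff_isoAsides :
    MaxContactCut.DFSpecialRung ↔ MaxContactCut.DFSpecialNonIso ∧ MaxContactCut.DFSpecialIso :=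
  deltaSpecialRung_iff_iso

/-- `RungOne` BY NAME from the decided aside and the two isolation-column asides. [folklore] -/
theorem closes_of_isoAsides (hG : MaxContactCut.DFGenericRung) (hN : MaxContactCut.DFSpecialNonIso)
    (hI : MaxContactCut.DFSpecialIso) : MaxContactCut.RungOne :=
  closes_of_iso hG hN hI

/-- LINEAGE EDGE: the g9 located residual 31577 implies the g11 one (and conversely modulo `DFGenericRung`). [folklore] -/
theorem dfSpecialRung_of_ffSpecialRung (h : MaxContactCut.FFSpecialRung) : MaxContactCut.DFSpecialRung :=
  deltaSpecialRung_of_ffSpecialRung h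

/-- LINEAGE EDGE: the g11 decided half implies the g9 one 31576. [folklore] -/
theorem ffGenericRung_of_dfGenericRung (h : MaxContactCut.DFGenericRung) : MaxContactCut.FFGenericRung :=
  ffGenericRung_of_deltaGenericRung h

end Summit.ResolutionOfSingularities.ResolutionOfSingularities.Theorems.MaxContactCutDeltaFaceCutAsides
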